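import Literature.Topology.FourManifolds.Rasmussen
import Literature.Topology.FourManifolds.HomotopyBallSliceProofs
import Literature.Topology.FourManifolds.GluckTwist
import Literature.Barriers.SmoothPoincare4.GluckTwistsDissolve
import Literature.Uncategorized.Crux

/-!
# The "slice in a Gluck twist" lever for `SVanishesOnPairs`: what it proves and what it bets on (negative lemmas for crux stmt-SmoothPoincare4-0368)

Crux `ZeroSurgeryExotic.ZseSVanishesOnPairs` (item `stmt-SmoothPoincare4-0368`) is the tree's registered
open statement `Literature.Uncategorized.SVanishesOnPairs`.  The picked proof line
`two-knot-meridional-dual` (lead `prover-line-ZseSVanishesOnPairs-lean-0`) runs through a transfer target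
"`K'` is slice in some Gluck twist of `S⁴`" (its stubs 1+2) and MMSW 2023 Cor 1.13 (its stub 3 = the
barrier fact `Literature.Barriers.SmoothPoincare4.rasmussen_eq_zero_of_isSliceDiscIn_gluckTwist`).  The
standing disprover could not read the skeleton's local definitions, so this file treats the COMPOSITE
lever, spelled out with tree vocabulary only (`IsGluckTwist`, `Knot.IsSliceDiscIn`):

  LEVER := on every `0`-surgery pair `(K, K')` with `K` smoothly slice, `K'` bounds a smooth proper disc
           off a ball in some smooth (Hausdorff, second countable) Gluck twist `X` of `S⁴`.

* `sVanishesOnPairs_of_gluckLever` — LEVER + MMSW Cor 1.13 prove the crux (sanity: the line closes).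
* `isSmoothlySlice_of_isSliceDiscIn_of_diffeomorph_sphere` — Palais per manifold (assembled from the
  tree's PROVED ball-complement theorem and neatening): a knot bounding a smooth proper disc off a ball
  in a 4-manifold that IS diffeomorphic to `S⁴` is smoothly slice.
* `exoticGluckTwist_of_gluckLever` — WHAT THE LINE BETS ON: under LEVER, any `0`-surgery pair with `K`
  slice and `K'` NOT slice (a witness of the route's thesis X) yields a Gluck twist of `S⁴` admitting NO
  diffeomorphism to `S⁴` — i.e. LEVER makes the whole Manolescu–Piccirillo programme factor through a
  negative answer to Kirby's Problem 4.24 (is every Gluck twist standard?); equivalently LEVER + "Gluck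
  twists are standard" give the route's kill switch (0-surgery type determines sliceness),
  `zeroSurgeryDeterminesSliceness_of_gluckLever_of_gluckStandard`.
Refuter negative/targets lemmas (cdisprove gen 1), supporting the crux item; no definitions.
-/

noncomputable section

open scoped Manifold ContDiff
open Literature.Topology.FourManifolds Literature.Uncategorized

namespace Summit.SmoothPoincare4.SmoothPoincare4.Theorems.ZseSVanishesOnPairs.Negative

/-- **LEVER + MMSW Cor 1.13 ⇒ the crux** (the line's assembly, composite form).
[cite: ManolescuMarengonSarkarWillis2023, Cor. 1.13] -/
theorem sVanishesOnPairs_of_gluckLever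
    (hL : ∀ (K K' : Knot) (Y : Type) [TopologicalSpace Y] [ChartedSpace (EuclideanSpace ℝ (Fin 3)) Y],
      IsIntegralSurgery (𝓡 3) Y K 0 → IsIntegralSurgery (𝓡 3) Y K' 0 → K.IsSmoothlySlice →
      ∃ (K₂ : TwoKnot) (X : Type) (_ : TopologicalSpace X) (_ : T2Space X)
        (_ : SecondCountableTopology X) (_ : ChartedSpace (EuclideanSpace ℝ (Fin 4)) X)
        (_ : IsManifold (𝓡 4) ∞ X), IsGluckTwist (𝓡 4) X K₂ ∧
          ∃ (e : EuclideanSpace ℝ (Fin 4) → X) (f : EuclideanSpace ℝ (Fin 2) → X), K'.IsSliceDiscIn X e f)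
    (h113 : Literature.Barriers.SmoothPoincare4.rasmussen_eq_zero_of_isSliceDiscIn_gluckTwist) :
    SVanishesOnPairs := by
  intro K K' Y _ _ s h1 h2 h3 h4
  obtain ⟨K₂, X, _, _, _, _, _, hX, e, f, hf⟩ := hL K K' Y h1 h2 h3
  exact h113 K₂ X hX K' e f hf s h4

/-- **Palais, per manifold**: if `K` bounds a smooth proper disc off a ball in a smooth 4-manifold `M`
and `M` is diffeomorphic to `S⁴`, then `K` is smoothly slice (transport the disc, pull it back to `B⁴`
through Palais' complementary ball — the tree's PROVED `Knot.palais_ballComplement_sphere_four_holds` —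
and neaten, `Knot.isSmoothlySlice_of_isProperDisc_holds`). [cite: Palais1960, Thm. B] -/
theorem isSmoothlySlice_of_isSliceDiscIn_of_diffeomorph_sphere {K : Knot} {M : Type} [TopologicalSpace M]
    [ChartedSpace (EuclideanSpace ℝ (Fin 4)) M] [IsManifold (𝓡 4) ∞ M]
    {e : EuclideanSpace ℝ (Fin 4) → M} {f : EuclideanSpace ℝ (Fin 2) → M} (h : K.IsSliceDiscIn M e f)
    (φ : M ≃ₘ⟮𝓡 4, 𝓡 4⟯ (Metric.sphere (0 : EuclideanSpace ℝ (Fin 5)) 1)) : K.IsSmoothlySlice := by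
  have h' := h.diffeomorph_comp φ
  obtain ⟨U, c, hc₁, hc₂⟩ :=
    Knot.palais_ballComplement_sphere_four_holds (φ ∘ e) h'.isSmoothEmbedding
  obtain ⟨g, hg⟩ := h'.exists_isProperDisc c hc₁ hc₂
  exact Knot.isSmoothlySlice_of_isProperDisc_holds K g hg

/-- **What the line bets on**: under LEVER, a `0`-surgery pair with `K` slice and `K'` not slice (a
witness of the route's thesis) produces a Gluck twist of `S⁴` with NO diffeomorphism to `S⁴`, carrying
a slice disc for the non-slice `K'`. So the line claims that the `0`-surgery route to an exotic `S⁴`, if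
it works at all, works through an exotic GLUCK TWIST (Kirby Problem 4.24) — strictly more than the crux
(which only needs `s(K') = 0`) and open even after one stabilisation (MMSW Question 9.12).
[cite: ManolescuMarengonSarkarWillis2023, Question 9.12] -/
theorem exoticGluckTwist_of_gluckLever
    (hL : ∀ (K K' : Knot) (Y : Type) [TopologicalSpace Y] [ChartedSpace (EuclideanSpace ℝ (Fin 3)) Y],
      IsIntegralSurgery (𝓡 3) Y K 0 → IsIntegralSurgery (𝓡 3) Y K' 0 → K.IsSmoothlySlice →
      ∃ (K₂ : TwoKnot) (X : Type) (_ : TopologicalSpace X) (_ : T2Space X)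
        (_ : SecondCountableTopology X) (_ : ChartedSpace (EuclideanSpace ℝ (Fin 4)) X)
        (_ : IsManifold (𝓡 4) ∞ X), IsGluckTwist (𝓡 4) X K₂ ∧
          ∃ (e : EuclideanSpace ℝ (Fin 4) → X) (f : EuclideanSpace ℝ (Fin 2) → X), K'.IsSliceDiscIn X e f)
    {K K' : Knot} {Y : Type} [TopologicalSpace Y] [ChartedSpace (EuclideanSpace ℝ (Fin 3)) Y]
    (h1 : IsIntegralSurgery (𝓡 3) Y K 0) (h2 : IsIntegralSurgery (𝓡 3) Y K' 0)
    (h3 : K.IsSmoothlySlice) (h4 : ¬ K'.IsSmoothlySlice) :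
    ∃ (K₂ : TwoKnot) (X : Type) (_ : TopologicalSpace X) (_ : T2Space X)
      (_ : SecondCountableTopology X) (_ : ChartedSpace (EuclideanSpace ℝ (Fin 4)) X)
      (_ : IsManifold (𝓡 4) ∞ X), IsGluckTwist (𝓡 4) X K₂ ∧
        IsEmpty (X ≃ₘ⟮𝓡 4, 𝓡 4⟯ (Metric.sphere (0 : EuclideanSpace ℝ (Fin 5)) 1)) ∧
        ∃ (e : EuclideanSpace ℝ (Fin 4) → X) (f : EuclideanSpace ℝ (Fin 2) → X),
          K'.IsSliceDiscIn X e f := by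
  obtain ⟨K₂, X, _, _, _, _, _, hX, e, f, hf⟩ := hL K K' Y h1 h2 h3
  exact ⟨K₂, X, _, ‹_›, ‹_›, _, ‹_›, hX,
    ⟨fun φ ↦ h4 (isSmoothlySlice_of_isSliceDiscIn_of_diffeomorph_sphere hf φ)⟩, e, f, hf⟩

/-- The same bet, read positively: LEVER + "every Gluck twist of `S⁴` is diffeomorphic to `S⁴`"
(Kirby Problem 4.24 affirmative) give "the `0`-surgery type determines smooth sliceness" — the body of the
route's kill switch (item 0367), which would close the route `refuted`. [cite: GluckTAMS1962, §17] -/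
theorem zeroSurgeryDeterminesSliceness_of_gluckLever_of_gluckStandard
    (hL : ∀ (K K' : Knot) (Y : Type) [TopologicalSpace Y] [ChartedSpace (EuclideanSpace ℝ (Fin 3)) Y],
      IsIntegralSurgery (𝓡 3) Y K 0 → IsIntegralSurgery (𝓡 3) Y K' 0 → K.IsSmoothlySlice →
      ∃ (K₂ : TwoKnot) (X : Type) (_ : TopologicalSpace X) (_ : T2Space X)
        (_ : SecondCountableTopology X) (_ : ChartedSpace (EuclideanSpace ℝ (Fin 4)) X)
        (_ : IsManifold (𝓡 4) ∞ X), IsGluckTwist (𝓡 4) X K₂ ∧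
          ∃ (e : EuclideanSpace ℝ (Fin 4) → X) (f : EuclideanSpace ℝ (Fin 2) → X), K'.IsSliceDiscIn X e f)
    (hStd : ∀ (K₂ : TwoKnot) (X : Type) [TopologicalSpace X] [T2Space X] [SecondCountableTopology X]
      [ChartedSpace (EuclideanSpace ℝ (Fin 4)) X] [IsManifold (𝓡 4) ∞ X], IsGluckTwist (𝓡 4) X K₂ →
      Nonempty (X ≃ₘ⟮𝓡 4, 𝓡 4⟯ (Metric.sphere (0 : EuclideanSpace ℝ (Fin 5)) 1)))
    (K K' : Knot) (Y : Type) [TopologicalSpace Y] [ChartedSpace (EuclideanSpace ℝ (Fin 3)) Y]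
    (h1 : IsIntegralSurgery (𝓡 3) Y K 0) (h2 : IsIntegralSurgery (𝓡 3) Y K' 0)
    (h3 : K.IsSmoothlySlice) : K'.IsSmoothlySlice := by
  obtain ⟨K₂, X, _, _, _, _, _, hX, e, f, hf⟩ := hL K K' Y h1 h2 h3
  obtain ⟨φ⟩ := hStd K₂ X hX
  exact isSmoothlySlice_of_isSliceDiscIn_of_diffeomorph_sphere hf φ

end Summit.SmoothPoincare4.SmoothPoincare4.Theorems.ZseSVanishesOnPairs.Negative
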